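import Mathlib
import Summits.QuantumFields.QCD.Theorems.PauliWegnerSeaPhaseQuenchedFlavourDecayPionSecondMomentOfCrux

/-!
# Stub `stub_doubletMinorSquare_wick` of line `crossing-split-integrability`
(crux `Summit.QuantumFields.QCD.Theses.PauliWegnerSea.PhaseQuenchedFlavourDecay`, item stmt-QuantumFields-9151)

**Squared `r × r` Wick minors of the quark propagator are honest `4r`-point Berezin ratios.**
For a mass-degenerate pair of flavours `f ≠ g`, `m_f = m_g`, in every gauge background `U` with
`det D(U) ≠ 0` and for all index tuples `I, J : Fin r → site × colour × spin`, the normalised Berezin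
integral of the flavour-mixed word
`Π_a ψ̄_g(I_a) ψ_f(I_a) · Π_b ψ̄_f(J_b) ψ_g(J_b)` against `e^{-ψ̄Dψ}` equals
`σ_r · Π_a ε(I_a) · Π_b ε(J_b) · |det [G_f(I_a, J_b)]_{a,b}|²`, `G = D⁻¹`, `ε = (1, 1, -1, -1)` the
diagonal of `γ₅`, with a sign `σ_r ∈ {±1}` depending on `r` alone (the determinant of the block swap
`[[0, 1], [1, 0]]`).  This is the rank-`r` generalisation of `pionPair_fermiRatio_eq` (`r = 1`).

Proof.
* Wick's rule with `k = r + r` pairs (`grassmannGaussian_wick` for the weight `e^{ψ̄(-D)ψ}`,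
  `(-D)⁻¹ = -D⁻¹`, and `det(-N) = det N` in even size `r + r`): the ratio is `det M`,
  `M_{cd} = G(j_c, i_d)` with `ψ`-indices `j = (f, I) ++ (g, J)` and `ψ̄`-indices `i = (g, I) ++ (f, J)`.
* `G` is flavour-diagonal (`inv_diracMatrix_apply_eq_zero_of_fst_ne`), so after reindexing along
  `Fin r ⊕ Fin r ≃ Fin (r + r)` the matrix is anti-block-diagonal, `M ≃ [[0, A], [B, 0]]`,
  `A_{ab} = G_f(I_a, J_b)`, `B_{ba} = G_g(J_b, I_a)`, and `[[0, A], [B, 0]] = [[A, 0], [0, B]] · S`,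
  `S = [[0, 1], [1, 0]]`, `S² = 1`, so `det M = det S · det A · det B`, `det S = ±1`.
* At equal masses `G_g = G_f` blockwise (`inv_diracMatrix_apply_same_flavour`) and γ₅-hermiticity
  `G(Q, P) = ε_Q conj(G(P, Q)) ε_P` (`inv_diracMatrix_apply_swap`) gives `B = diag(ε_J) Aᴴ diag(ε_I)`,
  whence `det B = Πε(J) · conj(det A) · Πε(I)` and `det A · conj(det A) = |det A|²`.

Sources: I. Montvay, G. Münster, *Quantum Fields on a Lattice* (CUP 1994), §4.1.3 (4.25) (Wick rule),
§5.1.2 (5.15) (γ₅-hermiticity); V. Mastropietro, *Non-Perturbative Renormalization* (2008), Ch. 2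
(2.12), (2.30).
-/

noncomputable section

namespace Summit.QuantumFields.QCD.Cruxes.PhaseQuenchedFlavourDecay.CrossingSplitIntegrability

open scoped BigOperators
open MeasureTheory Filter
open Literature.MathematicalPhysics.QuantumFieldTheory Literature.MathematicalPhysics.QuantumLattice
  Literature.Probability.LatticeModels

/-! ### Pure algebra: two-block words, even-size negation, anti-diagonal block determinants -/

/-- A product of `m + n` factors `φ(u ++ v)_c · χ(u' ++ v')_c` indexed along `Fin.append` splits as
the product of the first `m` factors times the product of the last `n` factors. -/
theorem prod_ofFn_append_mul {M : Type*} [Monoid M] {ι : Type*} {m n : ℕ} (φ χ : ι → M)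
    (u u' : Fin m → ι) (v v' : Fin n → ι) :
    (List.ofFn fun c : Fin (m + n) => φ (Fin.append u v c) * χ (Fin.append u' v' c)).prod =
      (List.ofFn fun a => φ (u a) * χ (u' a)).prod * (List.ofFn fun b => φ (v b) * χ (v' b)).prod := by
  have h : (fun c : Fin (m + n) => φ (Fin.append u v c) * χ (Fin.append u' v' c)) =
      Fin.append (fun a => φ (u a) * χ (u' a)) (fun b => φ (v b) * χ (v' b)) := by
    funext c
    induction c using Fin.addCases with
    | left a => simp only [Fin.append_left]
    | right b => simp only [Fin.append_right]
  rw [h, List.ofFn_fin_append, List.prod_append]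

/-- Negating every entry of a square matrix of EVEN size `r + r` does not change its determinant. -/
theorem det_of_neg_apply_fin_add_self {ι : Type*} {r : ℕ} (N : Matrix ι ι ℂ)
    (u v : Fin (r + r) → ι) :
    (Matrix.of fun a b => (-N) (u a) (v b)).det = (Matrix.of fun a b => N (u a) (v b)).det := by
  have h : (Matrix.of fun a b => (-N) (u a) (v b)) = -Matrix.of fun a b => N (u a) (v b) := by
    ext a b
    simp only [Matrix.of_apply, Matrix.neg_apply]
  rw [h, Matrix.det_neg, Fintype.card_fin, (Even.add_self r).neg_one_pow, one_mul]

/-- The block swap `S = [[0, 1], [1, 0]]` (blocks of size `r`) squares to one, so `det S = ±1`. -/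
theorem det_blockSwap_eq_one_or (r : ℕ) :
    (Matrix.fromBlocks 0 1 1 0 : Matrix (Fin r ⊕ Fin r) (Fin r ⊕ Fin r) ℂ).det = 1 ∨
      (Matrix.fromBlocks 0 1 1 0 : Matrix (Fin r ⊕ Fin r) (Fin r ⊕ Fin r) ℂ).det = -1 := by
  apply mul_self_eq_one_iff.mp
  rw [← Matrix.det_mul, Matrix.fromBlocks_multiply]
  simp

/-- Determinant of an anti-block-diagonal matrix: `det [[0, A], [B, 0]] = det S · det A · det B` with
`S = [[0, 1], [1, 0]]` the block swap (`[[0, A], [B, 0]] = [[A, 0], [0, B]] · S`). -/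
theorem det_fromBlocks_zero₁₁₂₂ {r : ℕ} (A B : Matrix (Fin r) (Fin r) ℂ) :
    (Matrix.fromBlocks 0 A B 0).det =
      (Matrix.fromBlocks 0 1 1 0 : Matrix (Fin r ⊕ Fin r) (Fin r ⊕ Fin r) ℂ).det * A.det * B.det := by
  have h : Matrix.fromBlocks 0 A B 0 =
      Matrix.fromBlocks A 0 0 B *
        (Matrix.fromBlocks 0 1 1 0 : Matrix (Fin r ⊕ Fin r) (Fin r ⊕ Fin r) ℂ) := by
    rw [Matrix.fromBlocks_multiply]
    simp
  rw [h, Matrix.det_mul, Matrix.det_fromBlocks_zero₂₁]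
  ring

/-! ### The Wick matrix of the flavour-mixed doublet word -/

/-- **Block structure of the Wick matrix of the flavour-mixed word.**  With `ψ`-indices
`j = ((f, I_a))_a ++ ((g, J_b))_b` and `ψ̄`-indices `i = ((g, I_a))_a ++ ((f, J_b))_b`, the Wick matrix
`M_{cd} = G(j_c, i_d)`, `G = D⁻¹`, has vanishing diagonal blocks (`G` is flavour-diagonal,
`inv_diracMatrix_apply_eq_zero_of_fst_ne`) and off-diagonal blocks `A_{ab} = G_f(I_a, J_b)`,
`B_{ba} = G_g(J_b, I_a)`: reindexed along `Fin r ⊕ Fin r ≃ Fin (r + r)` it is `[[0, A], [B, 0]]`. -/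
theorem doubletWickMatrix_submatrix_finSumFinEquiv {Nf L : ℕ} [NeZero L] (U : GaugeConfig 4 L SU3)
    (mq : Fin Nf → ℝ) {f g : Fin Nf} (hfg : f ≠ g) {r : ℕ}
    (I J : Fin r → TorusSite 4 L × Fin 3 × Fin 4) :
    (Matrix.of fun c d : Fin (r + r) =>
        (diracMatrix U mq)⁻¹
          (Fin.append (fun a => quarkEquiv (f, I a)) (fun b => quarkEquiv (g, J b)) c)
          (Fin.append (fun a => quarkEquiv (g, I a)) (fun b => quarkEquiv (f, J b)) d)).submatrix
        (finSumFinEquiv : Fin r ⊕ Fin r ≃ Fin (r + r)) (finSumFinEquiv : Fin r ⊕ Fin r ≃ Fin (r + r)) =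
      Matrix.fromBlocks 0
        (Matrix.of fun a b : Fin r =>
          (diracMatrix U mq)⁻¹ (quarkEquiv (f, I a)) (quarkEquiv (f, J b)))
        (Matrix.of fun b a : Fin r =>
          (diracMatrix U mq)⁻¹ (quarkEquiv (g, J b)) (quarkEquiv (g, I a)))
        0 := by
  ext (a | b) (a' | b') <;>
    simp only [Matrix.submatrix_apply, Matrix.of_apply, finSumFinEquiv_apply_left,
      finSumFinEquiv_apply_right, Fin.append_left, Fin.append_right, Matrix.fromBlocks_apply₁₁,
      Matrix.fromBlocks_apply₁₂, Matrix.fromBlocks_apply₂₁, Matrix.fromBlocks_apply₂₂,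
      Matrix.zero_apply]
  · exact inv_diracMatrix_apply_eq_zero_of_fst_ne U mq (v := (f, I a)) (w := (g, I a')) hfg
  · exact inv_diracMatrix_apply_eq_zero_of_fst_ne U mq (v := (g, J b)) (w := (f, J b')) (Ne.symm hfg)

/-- **The crossed block via γ₅-hermiticity.**  At equal masses `m_f = m_g` the one-flavour blocks of
`G = D⁻¹` coincide (`inv_diracMatrix_apply_same_flavour`), and `G(Q, P) = ε_Q conj(G(P, Q)) ε_P`
(`inv_diracMatrix_apply_swap`), so `B_{ba} = G_g(J_b, I_a) = ε(J_b) conj(A_{ab}) ε(I_a)`, i.e.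
`B = diag(ε_J) Aᴴ diag(ε_I)` with `A_{ab} = G_f(I_a, J_b)`. -/
theorem doubletCrossBlock_eq {Nf L : ℕ} [NeZero L] (U : GaugeConfig 4 L SU3) (mq : Fin Nf → ℝ)
    {f g : Fin Nf} (hm : mq f = mq g) (hD : (diracMatrix U mq).det ≠ 0) {r : ℕ}
    (I J : Fin r → TorusSite 4 L × Fin 3 × Fin 4) :
    (Matrix.of fun b a : Fin r => (diracMatrix U mq)⁻¹ (quarkEquiv (g, J b)) (quarkEquiv (g, I a))) =
      Matrix.diagonal (fun b => (![1, 1, -1, -1] : Fin 4 → ℂ) (J b).2.2) *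
          Matrix.conjTranspose (Matrix.of fun a b : Fin r =>
            (diracMatrix U mq)⁻¹ (quarkEquiv (f, I a)) (quarkEquiv (f, J b))) *
        Matrix.diagonal (fun a => (![1, 1, -1, -1] : Fin 4 → ℂ) (I a).2.2) := by
  have hall : ∀ f', (wilsonDirac (fundamentalRep (Fin 3)) U (mq f') 1).det ≠ 0 := by
    intro f'
    have h := hD
    rw [det_diracMatrix] at h
    exact (Finset.prod_ne_zero_iff.1 h) f' (Finset.mem_univ _)
  ext b a
  rw [Matrix.of_apply, Matrix.mul_diagonal, Matrix.diagonal_mul, Matrix.conjTranspose_apply,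
    Matrix.of_apply, inv_diracMatrix_apply_same_flavour U mq hall g (J b) (I a), ← hm,
    ← inv_diracMatrix_apply_same_flavour U mq hall f (J b) (I a),
    inv_diracMatrix_apply_swap U mq (quarkEquiv (f, I a)) (quarkEquiv (f, J b))]
  simp only [Equiv.symm_apply_apply]

/-- **The Wick determinant of the flavour-mixed doublet word.**
`det M = det S · Πε(I) · Πε(J) · |det A|²` with `A_{ab} = G_f(I_a, J_b)` and `S` the block swap:
`det M = det [[0, A], [B, 0]] = det S · det A · det B` (reindexing along `Fin r ⊕ Fin r ≃ Fin (r + r)`),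
`det B = Πε(J) · conj(det A) · Πε(I)` (`doubletCrossBlock_eq`, `det_conjTranspose`), and
`det A · conj(det A) = |det A|²`. -/
theorem det_doubletWickMatrix_eq {Nf L : ℕ} [NeZero L] (U : GaugeConfig 4 L SU3) (mq : Fin Nf → ℝ)
    {f g : Fin Nf} (hfg : f ≠ g) (hm : mq f = mq g) (hD : (diracMatrix U mq).det ≠ 0) {r : ℕ}
    (I J : Fin r → TorusSite 4 L × Fin 3 × Fin 4) :
    (Matrix.of fun c d : Fin (r + r) =>
        (diracMatrix U mq)⁻¹
          (Fin.append (fun a => quarkEquiv (f, I a)) (fun b => quarkEquiv (g, J b)) c)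
          (Fin.append (fun a => quarkEquiv (g, I a)) (fun b => quarkEquiv (f, J b)) d)).det =
      (Matrix.fromBlocks 0 1 1 0 : Matrix (Fin r ⊕ Fin r) (Fin r ⊕ Fin r) ℂ).det *
            (∏ a, (![1, 1, -1, -1] : Fin 4 → ℂ) (I a).2.2) *
          (∏ b, (![1, 1, -1, -1] : Fin 4 → ℂ) (J b).2.2) *
        (((‖(Matrix.of fun a b : Fin r =>
            (diracMatrix U mq)⁻¹ (quarkEquiv (f, I a)) (quarkEquiv (f, J b))).det‖ ^ 2 : ℝ) : ℂ)) := by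
  rw [← Matrix.det_submatrix_equiv_self (finSumFinEquiv : Fin r ⊕ Fin r ≃ Fin (r + r)),
    doubletWickMatrix_submatrix_finSumFinEquiv U mq hfg I J, det_fromBlocks_zero₁₁₂₂,
    doubletCrossBlock_eq U mq hm hD I J, Matrix.det_mul, Matrix.det_mul, Matrix.det_diagonal,
    Matrix.det_conjTranspose, Matrix.det_diagonal, ← Matrix.mul_star_eq_normSq_cast]
  ring

/-- ADDITIVE — for a mass-degenerate pair of flavours `f ≠ g` the squared `r × r` Wick minors
`|det [G_f(I_a, J_b)]|²` of the quark propagator are honest `4r`-point Berezin ratios: the flavour-mixed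
word `Π_a ψ̄_g(I_a) ψ_f(I_a) · Π_b ψ̄_f(J_b) ψ_g(J_b)` contracts to `σ_r · Πε(I) · Πε(J) · |det [G_f(I_a, J_b)]|²`
with `σ_r ∈ {±1}` depending on `r` alone (Wick rule + flavour-diagonality + γ₅-hermiticity). -/
theorem stub_doubletMinorSquare_wick :
    ∀ r : ℕ, ∃ σ : ℂ, (σ = 1 ∨ σ = -1) ∧
      ∀ (Nf L : ℕ) [NeZero L] (U : GaugeConfig 4 L SU3) (mq : Fin Nf → ℝ) (f g : Fin Nf), f ≠ g → mq f = mq g →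
        (diracMatrix U mq).det ≠ 0 →
        ∀ (I J : Fin r → TorusSite 4 L × Fin 3 × Fin 4),
          fermiIntegral ((List.ofFn fun a : Fin r => qbar (g, I a) * q (f, I a)).prod *
              (List.ofFn fun b : Fin r => qbar (f, J b) * q (g, J b)).prod * fermiBoltzmann U mq) /
            fermiIntegral (fermiBoltzmann U mq) =
          σ * (∏ a, (![1, 1, -1, -1] : Fin 4 → ℂ) (I a).2.2) * (∏ b, (![1, 1, -1, -1] : Fin 4 → ℂ) (J b).2.2) *
            (((‖(Matrix.of fun a b : Fin r => (diracMatrix U mq)⁻¹ (quarkEquiv (f, I a)) (quarkEquiv (f, J b))).det‖ ^ 2 : ℝ) : ℂ)) := by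
  intro r
  refine ⟨(Matrix.fromBlocks 0 1 1 0 : Matrix (Fin r ⊕ Fin r) (Fin r ⊕ Fin r) ℂ).det,
    det_blockSwap_eq_one_or r, ?_⟩
  intro Nf L _ U mq f g hfg hm hD I J
  have hD' : (-diracMatrix U mq).det ≠ 0 := by
    rw [Matrix.det_neg]
    exact mul_ne_zero (pow_ne_zero _ (neg_ne_zero.2 one_ne_zero)) hD
  have h := grassmannGaussian_wick ℂ (-diracMatrix U mq) hD'
    (Fin.append (fun a => quarkEquiv (g, I a)) (fun b => quarkEquiv (f, J b)))
    (Fin.append (fun a => quarkEquiv (f, I a)) (fun b => quarkEquiv (g, J b)))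
  rw [prod_ofFn_append_mul (psiBar ℂ (ι := FermiIdx Nf L)) (psi ℂ (ι := FermiIdx Nf L))] at h
  simp only [fermiIntegral, fermiBoltzmann, qbar, q]
  rw [mul_grassmannExp_quadratic_comm]
  refine h.trans ?_
  rw [inv_neg_of_isUnit_det _ (Ne.isUnit hD)]
  exact (det_of_neg_apply_fin_add_self _ _ _).trans (det_doubletWickMatrix_eq U mq hfg hm hD I J)

end Summit.QuantumFields.QCD.Cruxes.PhaseQuenchedFlavourDecay.CrossingSplitIntegrability

end
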